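import Mathlib.Algebra.Quaternion
import Mathlib.GroupTheory.DoubleCoset
import Mathlib.GroupTheory.Index
import Mathlib.LinearAlgebra.Matrix.Determinant.Basic
import Mathlib.RingTheory.IntegralClosure.IsIntegral.Basic
import Mathlib.NumberTheory.NumberField.Basic
import Literature.NumberTheory.Automorphic.QuaternionAlgebraAdelicReducedNormMulProofs
import Literature.NumberTheory.GaloisRepresentations.IntegralGaloisAction
import HarnessLib

/-!
# The coordinate order `R⟨1, i, j, k⟩` of `ℍ[K,a,b]`, its unit, norm-one and congruence groups

Topic `NumberTheory/Automorphic`. For a commutative ring `R` with an algebra map to a commutative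
ring `K` (in applications `R = 𝓞 K` the ring of integers of a number field `K`) and `a, b ∈ R`,
the **coordinate order**
`O = R⟨1, i, j, k⟩ = {x ∈ ℍ[K,a,b] : the four coordinates of x lie in (the image of) R}`
of Mathlib's quaternion algebra `ℍ[K,a,b] = QuaternionAlgebra K a 0 b` (`i² = a`, `j² = b`,
`k = ij = -ji`); coordinates are Mathlib's `QuaternionAlgebra.equivTuple` (`= ![re, imI, imJ, imK]`).
This is the lattice "engendré sur `R` par `(e)`" for the basis `(e) = (1, i, j, ij)` of Vignéras
(LNM 800, Ch. I §4 and Ch. III §5 A, example p. 85: `ℤ[1, i, j, ij]`), an `R`-order because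
`a, b ∈ R` make it a ring (Vignéras I §4, Prop. 4.2: an order is a full `R`-lattice which is a ring).

* `QuaternionAlgebra.coordOrder K a b : Subalgebra R ℍ[K,a,b]` — membership is LITERALLY
  `∀ i : Fin 4, equivTuple a 0 b x i ∈ Set.range (algebraMap R K)` (`mem_coordOrder_iff`, `Iff.rfl`;
  this is the inline predicate `IsInt` of the route `Summits/Langlands/Langlands/Theses/TorsionKudlaMillson`);
  `mem_coordOrder_iff'` (the four coordinates), `mem_coordOrder_iff_exists`;
* it is an order: `star_mem_coordOrder` (`x̄ ∈ O`), `coordOrder_toSubmodule_eq_span` (`O` is the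
  `R`-span of `1, i, j, k`), `fg_coordOrder`, `Module.Finite R O`, `isIntegral_of_mem_coordOrder`,
  `span_coordOrder_eq_top` (`K O = ℍ[K,a,b]`), and for `R → K` injective `coordOrderBasis`
  (`O` is `R`-free on `1, i, j, k`), `finrank_coordOrder = 4`;
* reduced trace and norm (the tree's `reducedTrace`, `reducedNorm` of
  `QuaternionAlgebraAdelic.lean`, `= 2 re` and `= re² - a imI² - b imJ² + ab imK²` on `ℍ[K,a,b]`):
  `reducedTrace_mem_range_of_mem_coordOrder`, `reducedNorm_mem_range_of_mem_coordOrder`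
  (`t(O), n(O) ⊆ R`), `mul_star_self_eq_algebraMap_reducedNorm` (`x x̄ = n(x)`),
  `det_reducedTrace_basisOneIJK` (the discriminant of the trace form on `1, i, j, k` is
  `-(4ab)²`, so the reduced discriminant of `O` is `4ab R`; Vignéras III §5, Cor. 5.3 and the
  example following it);
* `QuaternionAlgebra.unitGroup K a b : Subgroup ℍ[K,a,b]ˣ` — `O^×` inside `ℍ[K,a,b]ˣ`:
  `u ∈ O^× ↔ ↑u ∈ O ∧ ↑u⁻¹ ∈ O` (`mem_unitGroup_iff`, `Iff.rfl`; the route's `IsG`),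
  `unitGroupEquiv : unitGroup K a b ≃* (coordOrder K a b)ˣ`, and Vignéras I Lemme 4.12
  `mem_unitGroup_iff_exists_reducedNorm_eq` (`u ∈ O^× ↔ u ∈ O ∧ n(u) ∈ R^×`);
* `QuaternionAlgebra.normOneGroup K a b` — `O¹ = {u ∈ O^× : u ū = 1}` (the route's `u * star u = 1`;
  `= {n(u) = 1}` by `mul_star_self_eq_one_iff`);
* `QuaternionAlgebra.idealLattice K a b I` (`I O`, a two-sided ideal of `O` for an ideal `I ⊆ R`),
  `QuaternionAlgebra.congruenceSubgroup K a b I` — the principal congruence subgroup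
  `O^×(I) = {u ∈ O^× : u ≡ 1 mod I O}` (Vignéras IV §1, Définition p. 105: kernel of `O → O/IO` on
  units), `mem_congruenceSubgroup_span_singleton_iff` (for `I = (N)` literally the route's `Cong N`),
  and `normOneCongruenceSubgroup K a b I = O¹(I) = O¹ ⊓ O^×(I)`;
* the NAMED FACT `QuaternionAlgebra.coordOrder_heckeDoubleCoset` (D-0014): for a number field `K`,
  `a, b ∈ 𝓞 K ∖ 0` with `ℍ[K,a,b]` not totally definite (Eichler's condition for `S = ∞`), a finite
  place `v = (ϖ)` with `v ∤ 2ab` and `g ∈ O` with `g ḡ = ϖ`: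
  `O^× g O^× = {x ∈ O : n(x) ∈ (𝓞 K)^× ϖ}` and `[O^× : O^× ∩ g⁻¹ O^× g] = q_v + 1` (the Hecke
  operator `T_v = [O^× g O^×]` has `q_v + 1` right cosets and does not depend on `g`) — the
  global–adelic consequence of strong approximation (Vignéras III Thm. 4.3, IV Thm. 1.1 (2)), the
  local–global dictionary (III Prop. 5.1, IV Thm. 1.7) and the structure of `M(2, R_v)` (II Thm. 2.3);
  see its docstring for the derivation and for what is NOT claimed.

Design. `R`, `K` and `a b : R` are parameters and the algebra is
`ℍ[K, algebraMap R K a, algebraMap R K b]` (file-local notation `ℍ⟮K; R; a, b⟯`); for `R = 𝓞 K`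
this is syntactically the route's `ℍ[K, ↑a, ↑b]` up to the reducible coercion
`NumberField.RingOfIntegers.val`, so the route predicates are `Iff.rfl`-equal to membership here. General `c₂ ≠ 0` (Mathlib's `ℍ[K,c₁,c₂,c₃]`) is not treated.
Mathlib has no quaternion orders over Dedekind rings (`Brandt.IsOrder` of `BrandtXi.lean` is the
`ℤ`-lattice notion inside an abstract `ℚ`-algebra); nothing here duplicates Mathlib or the tree.
NOT here: maximality of `O_v` for `v ∤ 2ab` as a statement about completions, Eichler orders,
the Kudla–Millson special lattices of the route (separate file).

## References

* M.-F. Vignéras, *Arithmétique des algèbres de quaternions*, LNM 800 (1980): Ch. I §4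
  (Prop. 4.2, Lemme 4.12), Ch. II §2 Thm. 2.3, Ch. III §4 Thm. 4.3, §5 Prop. 5.1, Cor. 5.3,
  Ch. IV §1 Thm. 1.1, Définition p. 105, Thm. 1.7 [VignerasLNM800].
* G. Shimura, *Introduction to the arithmetic theory of automorphic functions* (1971), §3.1–3.3
  (abstract Hecke rings `R(Γ, Δ)`, `deg Γ α Γ = [Γ : Γ ∩ α⁻¹ Γ α]`) [Shimura1971].
-/

noncomputable section

open scoped Quaternion Pointwise

namespace Literature.NumberTheory.Automorphic

namespace QuaternionAlgebra

open _root_.QuaternionAlgebra (equivTuple equivTuple_apply basisOneIJK)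

/-- `ℍ⟮K; R; a, b⟯ := ℍ[K, algebraMap R K a, algebraMap R K b]`, the quaternion algebra containing
the coordinate order with parameters `a, b ∈ R` (file-local notation, does not leak). -/
local notation "ℍ⟮" K "; " R "; " a ", " b "⟯" =>
  QuaternionAlgebra K (algebraMap R K a) (0 : K) (algebraMap R K b)

/-! ### Coordinates in the image of `R` -/

section Coordinates

variable (R : Type*) {K : Type*} [CommRing R] [CommRing K] [Algebra R K]

/-- The structure map `R → ℍ[K,c₁,c₂,c₃]` of Mathlib's `Algebra R ℍ[K,c₁,c₂,c₃]` is `R → K ↪ ℍ`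
(definitional; recorded as a `simp` lemma so that coordinates of `algebraMap R _ r` compute).
[folklore] -/
@[simp]
theorem algebraMap_quaternionAlgebra_eq_coe (c₁ c₂ c₃ : K) (r : R) :
    algebraMap R ℍ[K,c₁,c₂,c₃] r = ((algebraMap R K r : K) : ℍ[K,c₁,c₂,c₃]) :=
  rfl

/-- The four coordinates of `x ∈ ℍ[K,c₁,c₃]` (`equivTuple = ![re, imI, imJ, imK]`) all lie in the
image of `R` iff `x = r₀ + r₁ i + r₂ j + r₃ k` with `rᵢ ∈ R`. [folklore] -/
theorem forall_equivTuple_mem_range_iff (c₁ c₃ : K) (x : ℍ[K,c₁,c₃]) :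
    (∀ i : Fin 4, equivTuple c₁ 0 c₃ x i ∈ Set.range (algebraMap R K)) ↔
      ∃ r₀ r₁ r₂ r₃ : R,
        x = ⟨algebraMap R K r₀, algebraMap R K r₁, algebraMap R K r₂, algebraMap R K r₃⟩ := by
  constructor
  · intro h
    obtain ⟨r₀, h₀⟩ := h 0
    obtain ⟨r₁, h₁⟩ := h 1
    obtain ⟨r₂, h₂⟩ := h 2
    obtain ⟨r₃, h₃⟩ := h 3
    simp only [equivTuple_apply, Matrix.cons_val_zero, Matrix.cons_val_one, Matrix.cons_val]
      at h₀ h₁ h₂ h₃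
    exact ⟨r₀, r₁, r₂, r₃, by ext <;> simp [h₀, h₁, h₂, h₃]⟩
  · rintro ⟨r₀, r₁, r₂, r₃, rfl⟩ i
    fin_cases i <;> simp

/-- The four coordinates of `x` lie in the image of a subset `S ⊆ K` iff each of `re, imI, imJ, imK`
does. [folklore] -/
theorem forall_equivTuple_mem_iff (c₁ c₃ : K) (S : Set K) (x : ℍ[K,c₁,c₃]) :
    (∀ i : Fin 4, equivTuple c₁ 0 c₃ x i ∈ S) ↔ x.re ∈ S ∧ x.imI ∈ S ∧ x.imJ ∈ S ∧ x.imK ∈ S := by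
  constructor
  · intro h
    have h₀ := h 0; have h₁ := h 1; have h₂ := h 2; have h₃ := h 3
    simp only [equivTuple_apply, Matrix.cons_val_zero, Matrix.cons_val_one, Matrix.cons_val]
      at h₀ h₁ h₂ h₃
    exact ⟨h₀, h₁, h₂, h₃⟩
  · rintro ⟨h₀, h₁, h₂, h₃⟩ i
    fin_cases i <;> simpa

end Coordinates

/-! ### The coordinate order -/

section Order

variable {R : Type*} (K : Type*) [CommRing R] [CommRing K] [Algebra R K] (a b : R)

/-- The **coordinate order** `O = R⟨1, i, j, k⟩ ⊆ ℍ[K,a,b]` (`a, b ∈ R`): the quaternions whose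
four coordinates `re, imI, imJ, imK` (Mathlib `QuaternionAlgebra.equivTuple`) lie in the image of
`R`; an `R`-subalgebra since `i² = a`, `j² = b`, `k² = -ab ∈ R` (Vignéras I §4 Prop. 4.2; the
lattice generated by the basis `(1, i, j, ij)`, III §5 example p. 85).
[cite: VignerasLNM800, Ch. I §4 Prop. 4.2 and Ch. III §5 A (example p. 85)] -/
def coordOrder : Subalgebra R ℍ⟮K; R; a, b⟯ where
  carrier := {x | ∀ i : Fin 4,
    equivTuple (algebraMap R K a) 0 (algebraMap R K b) x i ∈ Set.range (algebraMap R K)}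
  mul_mem' {x y} hx hy := by
    rw [Set.mem_setOf_eq, forall_equivTuple_mem_range_iff] at hx hy ⊢
    obtain ⟨r₀, r₁, r₂, r₃, rfl⟩ := hx
    obtain ⟨s₀, s₁, s₂, s₃, rfl⟩ := hy
    exact ⟨r₀ * s₀ + a * r₁ * s₁ + b * r₂ * s₂ - a * b * r₃ * s₃,
      r₀ * s₁ + r₁ * s₀ - b * r₂ * s₃ + b * r₃ * s₂,
      r₀ * s₂ + a * r₁ * s₃ + r₂ * s₀ - a * r₃ * s₁,
      r₀ * s₃ + r₁ * s₂ - r₂ * s₁ + r₃ * s₀, by ext <;> simp⟩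
  one_mem' := by
    rw [Set.mem_setOf_eq, forall_equivTuple_mem_range_iff]
    exact ⟨1, 0, 0, 0, by ext <;> simp⟩
  add_mem' {x y} hx hy := by
    rw [Set.mem_setOf_eq, forall_equivTuple_mem_range_iff] at hx hy ⊢
    obtain ⟨r₀, r₁, r₂, r₃, rfl⟩ := hx
    obtain ⟨s₀, s₁, s₂, s₃, rfl⟩ := hy
    exact ⟨r₀ + s₀, r₁ + s₁, r₂ + s₂, r₃ + s₃, by ext <;> simp⟩
  zero_mem' := by
    rw [Set.mem_setOf_eq, forall_equivTuple_mem_range_iff]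
    exact ⟨0, 0, 0, 0, by ext <;> simp⟩
  algebraMap_mem' r := by
    rw [Set.mem_setOf_eq, forall_equivTuple_mem_range_iff]
    exact ⟨r, 0, 0, 0, by ext <;> simp⟩

variable {K a b}

/-- Membership in the coordinate order is, by definition, integrality of the four coordinates
(the route predicate `IsInt`); not a `simp` lemma (the right-hand side is the raw `Fin 4` form),
use `mem_coordOrder_iff'` / `mem_coordOrder_iff_exists` to compute. [folklore] -/
theorem mem_coordOrder_iff {x : ℍ⟮K; R; a, b⟯} :
    x ∈ coordOrder K a b ↔ ∀ i : Fin 4,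
      equivTuple (algebraMap R K a) 0 (algebraMap R K b) x i ∈ Set.range (algebraMap R K) :=
  Iff.rfl

/-- `x ∈ O ↔ x = r₀ + r₁ i + r₂ j + r₃ k` with `rᵢ ∈ R`. [folklore] -/
theorem mem_coordOrder_iff_exists {x : ℍ⟮K; R; a, b⟯} :
    x ∈ coordOrder K a b ↔ ∃ r₀ r₁ r₂ r₃ : R,
      x = ⟨algebraMap R K r₀, algebraMap R K r₁, algebraMap R K r₂, algebraMap R K r₃⟩ :=
  forall_equivTuple_mem_range_iff R _ _ x

/-- `x ∈ O` iff each of `re x, imI x, imJ x, imK x` lies in the image of `R`. [folklore] -/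
theorem mem_coordOrder_iff' {x : ℍ⟮K; R; a, b⟯} :
    x ∈ coordOrder K a b ↔ x.re ∈ Set.range (algebraMap R K) ∧ x.imI ∈ Set.range (algebraMap R K) ∧
      x.imJ ∈ Set.range (algebraMap R K) ∧ x.imK ∈ Set.range (algebraMap R K) :=
  forall_equivTuple_mem_iff _ _ _ x

variable (K a b) in
/-- `r₀ + r₁ i + r₂ j + r₃ k ∈ O` for `rᵢ ∈ R`. [folklore] -/
theorem mk_mem_coordOrder (r₀ r₁ r₂ r₃ : R) :
    (⟨algebraMap R K r₀, algebraMap R K r₁, algebraMap R K r₂, algebraMap R K r₃⟩ :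
      ℍ⟮K; R; a, b⟯) ∈ coordOrder K a b :=
  mem_coordOrder_iff_exists.mpr ⟨r₀, r₁, r₂, r₃, rfl⟩

variable (K a b) in
/-- The basis vectors `1, i, j, k` (Mathlib `QuaternionAlgebra.basisOneIJK`) lie in `O`. [folklore] -/
theorem basisOneIJK_mem_coordOrder (i : Fin 4) :
    basisOneIJK (algebraMap R K a) 0 (algebraMap R K b) i ∈ coordOrder K a b := by
  rw [mem_coordOrder_iff_exists]
  fin_cases i
  · exact ⟨1, 0, 0, 0, by ext <;> simp [basisOneIJK]⟩
  · exact ⟨0, 1, 0, 0, by ext <;> simp [basisOneIJK]⟩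
  · exact ⟨0, 0, 1, 0, by ext <;> simp [basisOneIJK]⟩
  · exact ⟨0, 0, 0, 1, by ext <;> simp [basisOneIJK]⟩

/-- `O` is stable under conjugation: `x ∈ O ⇒ x̄ ∈ O` (`x̄ = t(x) - x`, Vignéras I §4).
[cite: VignerasLNM800, Ch. I §4 (proof of Lemme 4.12)] -/
theorem star_mem_coordOrder {x : ℍ⟮K; R; a, b⟯}
    (hx : x ∈ coordOrder K a b) : star x ∈ coordOrder K a b := by
  rw [mem_coordOrder_iff_exists] at hx ⊢
  obtain ⟨r₀, r₁, r₂, r₃, rfl⟩ := hx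
  exact ⟨r₀, -r₁, -r₂, -r₃, by ext <;> simp⟩

/-- A quaternion is the coordinate combination of `1, i, j, k`. [folklore] -/
theorem eq_sum_smul_basisOneIJK {c₁ c₃ : K} (x : ℍ[K,c₁,c₃]) :
    x = x.re • basisOneIJK c₁ 0 c₃ 0 + x.imI • basisOneIJK c₁ 0 c₃ 1 +
      x.imJ • basisOneIJK c₁ 0 c₃ 2 + x.imK • basisOneIJK c₁ 0 c₃ 3 := by
  ext <;> simp [basisOneIJK]

variable (K a b) in
/-- **`O` is the `R`-span of `1, i, j, k`** (the lattice generated by the basis; Vignéras III §5 A).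
[cite: VignerasLNM800, Ch. III §5 A] -/
theorem coordOrder_toSubmodule_eq_span :
    Subalgebra.toSubmodule (coordOrder K a b) =
      Submodule.span R (Set.range (basisOneIJK (algebraMap R K a) 0 (algebraMap R K b))) := by
  refine le_antisymm ?_ (Submodule.span_le.mpr ?_)
  · intro x hx
    rw [Subalgebra.mem_toSubmodule, mem_coordOrder_iff_exists] at hx
    obtain ⟨r₀, r₁, r₂, r₃, rfl⟩ := hx
    set e := basisOneIJK (algebraMap R K a) (0 : K) (algebraMap R K b) with he
    have hx : (⟨algebraMap R K r₀, algebraMap R K r₁, algebraMap R K r₂, algebraMap R K r₃⟩ :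
        ℍ⟮K; R; a, b⟯) = r₀ • e 0 + r₁ • e 1 + r₂ • e 2 + r₃ • e 3 := by
      ext <;> simp [he, basisOneIJK, Algebra.smul_def]
    rw [hx]
    refine add_mem (add_mem (add_mem ?_ ?_) ?_) ?_ <;>
      exact Submodule.smul_mem _ _ (Submodule.subset_span (Set.mem_range_self _))
  · rintro _ ⟨i, rfl⟩
    exact basisOneIJK_mem_coordOrder K a b i

variable (K a b) in
/-- `O` is a finitely generated `R`-module (a lattice; Vignéras I §4 Prop. 4.2 (1)).
[cite: VignerasLNM800, Ch. I §4 Prop. 4.2] -/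
theorem fg_coordOrder : (Subalgebra.toSubmodule (coordOrder K a b)).FG := by
  rw [coordOrder_toSubmodule_eq_span]
  exact Submodule.fg_span (Set.finite_range _)

/-- `O` is a finite `R`-module. [cite: VignerasLNM800, Ch. I §4 Prop. 4.2] -/
instance coordOrder.moduleFinite : Module.Finite R (coordOrder K a b) :=
  Module.Finite.iff_fg.mpr (fg_coordOrder K a b)

/-- Elements of the order `O` are integral over `R` (Vignéras I §4 Prop. 4.2: (1) ⇒ (2)).
[cite: VignerasLNM800, Ch. I §4 Prop. 4.2] -/
theorem isIntegral_of_mem_coordOrder {x : ℍ⟮K; R; a, b⟯}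
    (hx : x ∈ coordOrder K a b) : IsIntegral R x :=
  IsIntegral.of_mem_of_fg (coordOrder K a b) (fg_coordOrder K a b) x hx

variable (K a b) in
/-- `O` is a full lattice: `K O = ℍ[K,a,b]` (it contains the `K`-basis `1, i, j, k`).
[cite: VignerasLNM800, Ch. I §4 Prop. 4.2] -/
theorem span_coordOrder_eq_top :
    Submodule.span K (coordOrder K a b : Set ℍ⟮K; R; a, b⟯) = ⊤ := by
  refine eq_top_iff.mpr fun x _ => ?_
  rw [eq_sum_smul_basisOneIJK x]
  refine add_mem (add_mem (add_mem ?_ ?_) ?_) ?_ <;>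
    exact Submodule.smul_mem _ _ (Submodule.subset_span (basisOneIJK_mem_coordOrder K a b _))

section Free

variable (K a b)
variable [FaithfulSMul R K]

/-- For `R → K` injective, `O` is `R`-free on `1, i, j, k`. [cite: VignerasLNM800, Ch. III §5 A] -/
def coordOrderBasis : Module.Basis (Fin 4) R (coordOrder K a b) :=
  Module.Basis.mk
    (v := fun i => ⟨basisOneIJK (algebraMap R K a) 0 (algebraMap R K b) i,
      basisOneIJK_mem_coordOrder K a b i⟩)
    (by
      refine LinearIndependent.of_comp (Subalgebra.toSubmodule (coordOrder K a b)).subtype ?_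
      exact ((basisOneIJK (algebraMap R K a) 0 (algebraMap R K b)).linearIndependent
        ).restrict_scalars' R)
    (by
      rintro ⟨x, hx⟩ -
      obtain ⟨r₀, r₁, r₂, r₃, rfl⟩ := mem_coordOrder_iff_exists.mp hx
      set e := basisOneIJK (algebraMap R K a) (0 : K) (algebraMap R K b) with he
      have hsum : (⟨_, hx⟩ : coordOrder K a b) =
          r₀ • ⟨e 0, basisOneIJK_mem_coordOrder K a b 0⟩ +
          r₁ • ⟨e 1, basisOneIJK_mem_coordOrder K a b 1⟩ +
          r₂ • ⟨e 2, basisOneIJK_mem_coordOrder K a b 2⟩ +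
          r₃ • ⟨e 3, basisOneIJK_mem_coordOrder K a b 3⟩ := by
        apply Subtype.ext
        simp only [Subalgebra.coe_add, Subalgebra.coe_smul]
        ext <;> simp [he, basisOneIJK, Algebra.smul_def]
      rw [hsum]
      refine add_mem (add_mem (add_mem ?_ ?_) ?_) ?_ <;>
        exact Submodule.smul_mem _ _ (Submodule.subset_span (Set.mem_range_self _)))

/-- The basis vectors of `coordOrderBasis` are `1, i, j, k`. [folklore] -/
@[simp]
theorem coe_coordOrderBasis_apply (i : Fin 4) :
    (coordOrderBasis K a b i : ℍ⟮K; R; a, b⟯) =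
      basisOneIJK (algebraMap R K a) 0 (algebraMap R K b) i := by
  simp [coordOrderBasis]

/-- `O` is a free `R`-module (for `R → K` injective). [cite: VignerasLNM800, Ch. III §5 A] -/
instance coordOrder.moduleFree : Module.Free R (coordOrder K a b) :=
  Module.Free.of_basis (coordOrderBasis K a b)

/-- `rank_R O = 4` (for `R → K` injective, `R` non-trivial). [cite: VignerasLNM800, Ch. III §5 A] -/
theorem finrank_coordOrder [Nontrivial R] : Module.finrank R (coordOrder K a b) = 4 := by
  rw [Module.finrank_eq_card_basis (coordOrderBasis K a b), Fintype.card_fin]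

end Free

end Order

/-! ### Reduced trace, reduced norm and discriminant on the coordinate order -/

section Norm

variable {R : Type*} (K : Type*) [CommRing R] [Field K] [Algebra R K] (a b : R)

/-- `x x̄ = n(x)` in `ℍ[K,c₁,c₃]` for the tree's reduced norm (`2 ≠ 0` in `K`): Mathlib's `star`
is the standard involution and `n = re² - c₁ imI² - c₃ imJ² + c₁c₃ imK²` (Vignéras I §1 Lemme 1.1).
[cite: VignerasLNM800, Ch. I §1 Lemme 1.1] -/
theorem mul_star_self_eq_algebraMap_reducedNorm [NeZero (2 : K)] {c₁ c₃ : K} (x : ℍ[K,c₁,c₃]) :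
    x * star x = algebraMap K ℍ[K,c₁,c₃] (reducedNorm K ℍ[K,c₁,c₃] x) := by
  rw [reducedNorm_quaternionAlgebra, self_mul_star_eq_algebraMap]

/-- `x x̄ = 1 ↔ n(x) = 1` in `ℍ[K,c₁,c₃]` (`2 ≠ 0` in `K`). [folklore] -/
theorem mul_star_self_eq_one_iff [NeZero (2 : K)] {c₁ c₃ : K} (x : ℍ[K,c₁,c₃]) :
    x * star x = 1 ↔ reducedNorm K ℍ[K,c₁,c₃] x = 1 := by
  rw [mul_star_self_eq_algebraMap_reducedNorm, ← map_one (algebraMap K ℍ[K,c₁,c₃]),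
    (_root_.QuaternionAlgebra.algebraMap_injective).eq_iff]

/-- `t(O) ⊆ R`: the reduced trace `t(x) = 2 re x` of an element of `O` lies in (the image of) `R`
(Vignéras I §4 Lemme 4.1). [cite: VignerasLNM800, Ch. I §4 Lemme 4.1] -/
theorem reducedTrace_mem_range_of_mem_coordOrder [NeZero (2 : K)]
    {x : ℍ⟮K; R; a, b⟯} (hx : x ∈ coordOrder K a b) :
    reducedTrace K _ x ∈ Set.range (algebraMap R K) := by
  obtain ⟨r₀, r₁, r₂, r₃, rfl⟩ := mem_coordOrder_iff_exists.mp hx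
  exact ⟨2 * r₀, by rw [reducedTrace_quaternionAlgebra, map_mul, map_ofNat]⟩

/-- `n(O) ⊆ R`: the reduced norm of `x = r₀ + r₁ i + r₂ j + r₃ k ∈ O` is
`r₀² - a r₁² - b r₂² + ab r₃² ∈ R` (Vignéras I §4 Lemme 4.1). [cite: VignerasLNM800, Ch. I §4 Lemme 4.1] -/
theorem reducedNorm_mem_range_of_mem_coordOrder [NeZero (2 : K)]
    {x : ℍ⟮K; R; a, b⟯} (hx : x ∈ coordOrder K a b) :
    reducedNorm K _ x ∈ Set.range (algebraMap R K) := by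
  obtain ⟨r₀, r₁, r₂, r₃, rfl⟩ := mem_coordOrder_iff_exists.mp hx
  exact ⟨r₀ ^ 2 - a * r₁ ^ 2 - b * r₂ ^ 2 + a * b * r₃ ^ 2, by
    rw [reducedNorm_quaternionAlgebra]; simp⟩

/-- **Discriminant of the trace form on `1, i, j, k`**: `det (t(eᵢ eⱼ)) = -(4 c₁ c₃)²`
(the matrix is `diag(2, 2c₁, 2c₃, -2c₁c₃)`), so the discriminant of the coordinate order
`R⟨1,i,j,k⟩` of `ℍ[K,a,b]` is `(4ab)² R` and its reduced discriminant `|det t(eᵢeⱼ)|^{1/2}` is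
`4ab R` (Vignéras III §5, example after Cor. 5.3: "le discriminant réduit `|dét t(eᵢeⱼ)|^{1/2}` de
l'ordre `ℤ[1,i,j,ij]`"). [cite: VignerasLNM800, Ch. III §5 Cor. 5.3 and the example following it] -/
theorem det_reducedTrace_basisOneIJK [NeZero (2 : K)] (c₁ c₃ : K) :
    (Matrix.of fun i j : Fin 4 => reducedTrace K ℍ[K,c₁,c₃]
      (basisOneIJK c₁ 0 c₃ i * basisOneIJK c₁ 0 c₃ j)).det = -(4 * c₁ * c₃) ^ 2 := by
  have hM : (Matrix.of fun i j : Fin 4 => reducedTrace K ℍ[K,c₁,c₃]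
      (basisOneIJK c₁ 0 c₃ i * basisOneIJK c₁ 0 c₃ j)) =
      Matrix.diagonal ![2, 2 * c₁, 2 * c₃, -(2 * c₁ * c₃)] := by
    ext i j
    fin_cases i <;> fin_cases j <;>
      simp [reducedTrace_quaternionAlgebra, basisOneIJK, Matrix.diagonal]
    ring
  rw [hM, Matrix.det_diagonal]
  simp [Fin.prod_univ_four]
  ring

end Norm

/-! ### Unit group, norm-one group, congruence subgroups -/

section Units

variable {R : Type*} (K : Type*) [CommRing R] [CommRing K] [Algebra R K] (a b : R)

/-- The **unit group `O^×`** of the coordinate order, as a subgroup of `ℍ[K,a,b]ˣ`: the units `u`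
of `ℍ[K,a,b]` with `u ∈ O` and `u⁻¹ ∈ O` (Mathlib `Submonoid.units`; Vignéras IV §1, the groups
`O^×`, `O¹` of an `R`-order). [cite: VignerasLNM800, Ch. IV §1] -/
def unitGroup : Subgroup (ℍ⟮K; R; a, b⟯)ˣ :=
  (coordOrder K a b).toSubmonoid.units

variable {K a b} in
/-- `u ∈ O^× ↔ ↑u ∈ O ∧ ↑u⁻¹ ∈ O` — by definition (the route predicate `IsG`). [folklore] -/
@[simp]
theorem mem_unitGroup_iff {u : (ℍ⟮K; R; a, b⟯)ˣ} :
    u ∈ unitGroup K a b ↔ (u : ℍ⟮K; R; a, b⟯) ∈ coordOrder K a b ∧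
      ((u⁻¹ : (ℍ⟮K; R; a, b⟯)ˣ) :
        ℍ⟮K; R; a, b⟯) ∈ coordOrder K a b :=
  Iff.rfl

/-- `O^× ⊆ ℍ[K,a,b]ˣ` is canonically the unit group of the ring `O` (Mathlib
`Submonoid.unitsEquivUnitsType`). [folklore] -/
def unitGroupEquiv : unitGroup K a b ≃* (coordOrder K a b)ˣ :=
  (coordOrder K a b).toSubmonoid.unitsEquivUnitsType

/-- The **norm-one group `O¹ = {u ∈ O^× : u ū = 1}`** as a subgroup of `ℍ[K,a,b]ˣ` (Vignéras IV §1: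
`O¹ = {x ∈ O, n(x) = 1}`; `u ū = n(u)`, see `mul_star_self_eq_one_iff`). [cite: VignerasLNM800, Ch. IV §1] -/
def normOneGroup : Subgroup (ℍ⟮K; R; a, b⟯)ˣ where
  carrier := {u | u ∈ unitGroup K a b ∧
    (u : ℍ⟮K; R; a, b⟯) * star (u : ℍ⟮K; R; a, b⟯) = 1}
  mul_mem' {u v} hu hv := by
    refine ⟨mul_mem hu.1 hv.1, ?_⟩
    calc ((u * v : (ℍ⟮K; R; a, b⟯)ˣ) : ℍ⟮K; R; a, b⟯) *
          star ((u * v : (ℍ⟮K; R; a, b⟯)ˣ) : ℍ⟮K; R; a, b⟯)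
        = (u : ℍ⟮K; R; a, b⟯) * ((v : ℍ⟮K; R; a, b⟯) * star (v : ℍ⟮K; R; a, b⟯)) * star (u : ℍ⟮K; R; a, b⟯) := by
          rw [Units.val_mul, star_mul]; noncomm_ring
      _ = 1 := by rw [hv.2, mul_one, hu.2]
  one_mem' := ⟨one_mem _, by simp⟩
  inv_mem' {u} hu := by
    refine ⟨inv_mem hu.1, ?_⟩
    have h : ((u⁻¹ : (ℍ⟮K; R; a, b⟯)ˣ) : ℍ⟮K; R; a, b⟯) =
        star (u : ℍ⟮K; R; a, b⟯) := Units.inv_eq_of_mul_eq_one_right hu.2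
    rw [h, star_star, star_comm_self', hu.2]

variable {K a b} in
/-- `u ∈ O¹ ↔ u ∈ O^× ∧ u ū = 1` — by definition (the route predicate: `IsG u ∧ u * star u = 1`).
[folklore] -/
@[simp]
theorem mem_normOneGroup_iff {u : (ℍ⟮K; R; a, b⟯)ˣ} :
    u ∈ normOneGroup K a b ↔ u ∈ unitGroup K a b ∧
      (u : ℍ⟮K; R; a, b⟯) * star (u : ℍ⟮K; R; a, b⟯) = 1 :=
  Iff.rfl

/-- `O¹ ≤ O^×`. [folklore] -/
theorem normOneGroup_le_unitGroup : normOneGroup K a b ≤ unitGroup K a b := fun _ hu => hu.1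

/-- The lattice `I O = {x ∈ ℍ[K,a,b] : all coordinates in the image of I}` for an ideal `I ⊆ R`,
as an `R`-submodule; it is a two-sided ideal of `O` (`idealLattice_mul_mem`, `mul_idealLattice_mem`)
and `u ≡ 1 mod I O` defines the principal congruence subgroups (Vignéras IV §1 Définition).
[cite: VignerasLNM800, Ch. IV §1 Définition (groupe de congruence principal)] -/
def idealLattice (I : Ideal R) : Submodule R ℍ⟮K; R; a, b⟯ where
  carrier := {x | ∀ i : Fin 4,
    equivTuple (algebraMap R K a) 0 (algebraMap R K b) x i ∈ algebraMap R K '' I}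
  add_mem' {x y} hx hy := by
    rw [Set.mem_setOf_eq, forall_equivTuple_mem_iff] at hx hy ⊢
    obtain ⟨⟨r₀, hr₀, h₀⟩, ⟨r₁, hr₁, h₁⟩, ⟨r₂, hr₂, h₂⟩, ⟨r₃, hr₃, h₃⟩⟩ := hx
    obtain ⟨⟨s₀, hs₀, k₀⟩, ⟨s₁, hs₁, k₁⟩, ⟨s₂, hs₂, k₂⟩, ⟨s₃, hs₃, k₃⟩⟩ := hy
    exact ⟨⟨r₀ + s₀, add_mem hr₀ hs₀, by simp [h₀, k₀]⟩, ⟨r₁ + s₁, add_mem hr₁ hs₁, by simp [h₁, k₁]⟩,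
      ⟨r₂ + s₂, add_mem hr₂ hs₂, by simp [h₂, k₂]⟩, ⟨r₃ + s₃, add_mem hr₃ hs₃, by simp [h₃, k₃]⟩⟩
  zero_mem' := by
    rw [Set.mem_setOf_eq, forall_equivTuple_mem_iff]
    exact ⟨⟨0, zero_mem I, by simp⟩, ⟨0, zero_mem I, by simp⟩, ⟨0, zero_mem I, by simp⟩,
      ⟨0, zero_mem I, by simp⟩⟩
  smul_mem' r {x} hx := by
    rw [Set.mem_setOf_eq, forall_equivTuple_mem_iff] at hx ⊢
    obtain ⟨⟨r₀, hr₀, h₀⟩, ⟨r₁, hr₁, h₁⟩, ⟨r₂, hr₂, h₂⟩, ⟨r₃, hr₃, h₃⟩⟩ := hx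
    exact ⟨⟨r * r₀, I.mul_mem_left r hr₀, by simp [h₀, Algebra.smul_def]⟩,
      ⟨r * r₁, I.mul_mem_left r hr₁, by simp [h₁, Algebra.smul_def]⟩,
      ⟨r * r₂, I.mul_mem_left r hr₂, by simp [h₂, Algebra.smul_def]⟩,
      ⟨r * r₃, I.mul_mem_left r hr₃, by simp [h₃, Algebra.smul_def]⟩⟩

variable {K a b}

/-- Membership in `I O` is, by definition, that the four coordinates lie in the image of `I`.
[folklore] -/
theorem mem_idealLattice_iff {I : Ideal R} {x : ℍ⟮K; R; a, b⟯} :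
    x ∈ idealLattice K a b I ↔ ∀ i : Fin 4,
      equivTuple (algebraMap R K a) 0 (algebraMap R K b) x i ∈ algebraMap R K '' I :=
  Iff.rfl

/-- `x ∈ I O ↔ x = r₀ + r₁ i + r₂ j + r₃ k` with all `rᵢ ∈ I`. [folklore] -/
theorem mem_idealLattice_iff_exists {I : Ideal R} {x : ℍ⟮K; R; a, b⟯} :
    x ∈ idealLattice K a b I ↔ ∃ r₀ ∈ I, ∃ r₁ ∈ I, ∃ r₂ ∈ I, ∃ r₃ ∈ I,
      x = ⟨algebraMap R K r₀, algebraMap R K r₁, algebraMap R K r₂, algebraMap R K r₃⟩ := by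
  rw [mem_idealLattice_iff, forall_equivTuple_mem_iff]
  constructor
  · rintro ⟨⟨r₀, hr₀, h₀⟩, ⟨r₁, hr₁, h₁⟩, ⟨r₂, hr₂, h₂⟩, ⟨r₃, hr₃, h₃⟩⟩
    exact ⟨r₀, hr₀, r₁, hr₁, r₂, hr₂, r₃, hr₃, by ext <;> simp [h₀, h₁, h₂, h₃]⟩
  · rintro ⟨r₀, hr₀, r₁, hr₁, r₂, hr₂, r₃, hr₃, rfl⟩
    exact ⟨⟨r₀, hr₀, rfl⟩, ⟨r₁, hr₁, rfl⟩, ⟨r₂, hr₂, rfl⟩, ⟨r₃, hr₃, rfl⟩⟩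

/-- `I O ⊆ O`. [folklore] -/
theorem idealLattice_le_coordOrder (I : Ideal R) :
    idealLattice K a b I ≤ Subalgebra.toSubmodule (coordOrder K a b) := by
  intro x hx
  obtain ⟨r₀, -, r₁, -, r₂, -, r₃, -, rfl⟩ := mem_idealLattice_iff_exists.mp hx
  exact mk_mem_coordOrder K a b r₀ r₁ r₂ r₃

/-- `I O` is a right `O`-module: `x ∈ I O`, `y ∈ O ⇒ x y ∈ I O`. [folklore] -/
theorem idealLattice_mul_mem {I : Ideal R} {x y : ℍ⟮K; R; a, b⟯}
    (hx : x ∈ idealLattice K a b I) (hy : y ∈ coordOrder K a b) : x * y ∈ idealLattice K a b I := by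
  obtain ⟨r₀, hr₀, r₁, hr₁, r₂, hr₂, r₃, hr₃, rfl⟩ := mem_idealLattice_iff_exists.mp hx
  obtain ⟨s₀, s₁, s₂, s₃, rfl⟩ := mem_coordOrder_iff_exists.mp hy
  rw [mem_idealLattice_iff_exists]
  refine ⟨r₀ * s₀ + a * r₁ * s₁ + b * r₂ * s₂ - a * b * r₃ * s₃, ?_,
    r₀ * s₁ + r₁ * s₀ - b * r₂ * s₃ + b * r₃ * s₂, ?_,
    r₀ * s₂ + a * r₁ * s₃ + r₂ * s₀ - a * r₃ * s₁, ?_,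
    r₀ * s₃ + r₁ * s₂ - r₂ * s₁ + r₃ * s₀, ?_, by ext <;> simp⟩
  · refine sub_mem (add_mem (add_mem (I.mul_mem_right _ hr₀) ?_) ?_) ?_
    · rw [mul_comm a, mul_assoc]; exact I.mul_mem_right _ hr₁
    · rw [mul_comm b, mul_assoc]; exact I.mul_mem_right _ hr₂
    · rw [mul_comm (a * b), mul_assoc]; exact I.mul_mem_right _ hr₃
  · refine add_mem (sub_mem (add_mem (I.mul_mem_right _ hr₀) (I.mul_mem_right _ hr₁)) ?_) ?_
    · rw [mul_comm b, mul_assoc]; exact I.mul_mem_right _ hr₂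
    · rw [mul_comm b, mul_assoc]; exact I.mul_mem_right _ hr₃
  · refine sub_mem (add_mem (add_mem (I.mul_mem_right _ hr₀) ?_) (I.mul_mem_right _ hr₂)) ?_
    · rw [mul_comm a, mul_assoc]; exact I.mul_mem_right _ hr₁
    · rw [mul_comm a, mul_assoc]; exact I.mul_mem_right _ hr₃
  · exact add_mem (sub_mem (add_mem (I.mul_mem_right _ hr₀) (I.mul_mem_right _ hr₁))
      (I.mul_mem_right _ hr₂)) (I.mul_mem_right _ hr₃)

/-- `I O` is a left `O`-module: `x ∈ O`, `y ∈ I O ⇒ x y ∈ I O`. [folklore] -/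
theorem mul_idealLattice_mem {I : Ideal R} {x y : ℍ⟮K; R; a, b⟯}
    (hx : x ∈ coordOrder K a b) (hy : y ∈ idealLattice K a b I) : x * y ∈ idealLattice K a b I := by
  obtain ⟨r₀, r₁, r₂, r₃, rfl⟩ := mem_coordOrder_iff_exists.mp hx
  obtain ⟨s₀, hs₀, s₁, hs₁, s₂, hs₂, s₃, hs₃, rfl⟩ := mem_idealLattice_iff_exists.mp hy
  rw [mem_idealLattice_iff_exists]
  refine ⟨r₀ * s₀ + a * r₁ * s₁ + b * r₂ * s₂ - a * b * r₃ * s₃, ?_,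
    r₀ * s₁ + r₁ * s₀ - b * r₂ * s₃ + b * r₃ * s₂, ?_,
    r₀ * s₂ + a * r₁ * s₃ + r₂ * s₀ - a * r₃ * s₁, ?_,
    r₀ * s₃ + r₁ * s₂ - r₂ * s₁ + r₃ * s₀, ?_, by ext <;> simp⟩
  · exact sub_mem (add_mem (add_mem (I.mul_mem_left _ hs₀) (I.mul_mem_left _ hs₁))
      (I.mul_mem_left _ hs₂)) (I.mul_mem_left _ hs₃)
  · exact add_mem (sub_mem (add_mem (I.mul_mem_left _ hs₁) (I.mul_mem_left _ hs₀))
      (I.mul_mem_left _ hs₃)) (I.mul_mem_left _ hs₂)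
  · exact sub_mem (add_mem (add_mem (I.mul_mem_left _ hs₂) (I.mul_mem_left _ hs₃))
      (I.mul_mem_left _ hs₀)) (I.mul_mem_left _ hs₁)
  · exact add_mem (sub_mem (add_mem (I.mul_mem_left _ hs₃) (I.mul_mem_left _ hs₂))
      (I.mul_mem_left _ hs₁)) (I.mul_mem_left _ hs₀)

variable (K a b)

/-- The **principal congruence subgroup `O^×(I) = {u ∈ O^× : u ≡ 1 mod I O}`** of level an ideal
`I ⊆ R`, as a subgroup of `ℍ[K,a,b]ˣ` (Vignéras IV §1, Définition: the kernel on units of the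
canonical map `O → O / IO` for the two-sided ideal `IO`). [cite: VignerasLNM800, Ch. IV §1 Définition (groupe de congruence principal)] -/
def congruenceSubgroup (I : Ideal R) : Subgroup (ℍ⟮K; R; a, b⟯)ˣ where
  carrier := {u | u ∈ unitGroup K a b ∧
    (u : ℍ⟮K; R; a, b⟯) - 1 ∈ idealLattice K a b I}
  mul_mem' {u v} hu hv := by
    refine ⟨mul_mem hu.1 hv.1, ?_⟩
    have h : ((u * v : (ℍ⟮K; R; a, b⟯)ˣ) : ℍ⟮K; R; a, b⟯) - 1 =
        ((u : ℍ⟮K; R; a, b⟯) - 1) * (v : ℍ⟮K; R; a, b⟯) + ((v : ℍ⟮K; R; a, b⟯) - 1) := by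
      rw [Units.val_mul]; noncomm_ring
    rw [h]
    exact add_mem (idealLattice_mul_mem hu.2 hv.1.1) hv.2
  one_mem' := ⟨one_mem _, by simp⟩
  inv_mem' {u} hu := by
    refine ⟨inv_mem hu.1, ?_⟩
    have h : ((u⁻¹ : (ℍ⟮K; R; a, b⟯)ˣ) : ℍ⟮K; R; a, b⟯) - 1 =
        -(((u⁻¹ : (ℍ⟮K; R; a, b⟯)ˣ) : ℍ⟮K; R; a, b⟯) * ((u : ℍ⟮K; R; a, b⟯) - 1)) := by
      rw [mul_sub, mul_one, Units.inv_mul, neg_sub]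
    rw [h]
    exact neg_mem (mul_idealLattice_mem hu.1.2 hu.2)

variable {K a b} in
/-- `u ∈ O^×(I) ↔ u ∈ O^× ∧ u - 1 ∈ I O` — by definition. [folklore] -/
@[simp]
theorem mem_congruenceSubgroup_iff {I : Ideal R} {u : (ℍ⟮K; R; a, b⟯)ˣ} :
    u ∈ congruenceSubgroup K a b I ↔ u ∈ unitGroup K a b ∧
      (u : ℍ⟮K; R; a, b⟯) - 1 ∈ idealLattice K a b I :=
  Iff.rfl

/-- `O^×(I) ≤ O^×`. [folklore] -/
theorem congruenceSubgroup_le_unitGroup (I : Ideal R) :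
    congruenceSubgroup K a b I ≤ unitGroup K a b := fun _ hu => hu.1

variable {K a b} in
/-- For a principal level `I = (N)` membership in `O^×(N)` is literally the route predicate `Cong N`:
`u ∈ O^×` and every coordinate of `u - 1` is of the form `N y`, `y ∈ R`. [folklore] -/
theorem mem_congruenceSubgroup_span_singleton_iff (N : R)
    {u : (ℍ⟮K; R; a, b⟯)ˣ} :
    u ∈ congruenceSubgroup K a b (Ideal.span {N}) ↔ u ∈ unitGroup K a b ∧ ∀ i : Fin 4,
      equivTuple (algebraMap R K a) 0 (algebraMap R K b) ((u : ℍ⟮K; R; a, b⟯) - 1) i ∈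
        Set.range (fun y : R => algebraMap R K (N * y)) := by
  rw [mem_congruenceSubgroup_iff, mem_idealLattice_iff]
  refine and_congr_right fun _ => forall_congr' fun i => ?_
  have hS : algebraMap R K '' (Ideal.span {N} : Ideal R) =
      Set.range (fun y : R => algebraMap R K (N * y)) := by
    ext z
    simp only [Set.mem_image, SetLike.mem_coe, Ideal.mem_span_singleton', Set.mem_range]
    constructor
    · rintro ⟨_, ⟨y, rfl⟩, rfl⟩; exact ⟨y, by rw [mul_comm]⟩
    · rintro ⟨y, rfl⟩; exact ⟨N * y, ⟨y, mul_comm y N⟩, rfl⟩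
  rw [hS]

/-- The **norm-one principal congruence subgroup `O¹(I) = O¹ ⊓ O^×(I)`** (Vignéras IV §1: the
principal congruence subgroup of `O¹` modulo the two-sided ideal `IO`).
[cite: VignerasLNM800, Ch. IV §1 Définition (groupe de congruence principal)] -/
abbrev normOneCongruenceSubgroup (I : Ideal R) :
    Subgroup (ℍ⟮K; R; a, b⟯)ˣ :=
  normOneGroup K a b ⊓ congruenceSubgroup K a b I

end Units

/-! ### Units of `O` are its elements of unit reduced norm (Vignéras I Lemme 4.12) -/

section UnitsNorm

variable {R : Type*} (K : Type*) [CommRing R] [Field K] [Algebra R K] [NeZero (2 : K)]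
  [FaithfulSMul R K] (a b : R)

variable {K a b} in
/-- **Vignéras I Lemme 4.12** for the coordinate order: `x ∈ O` is a two-sided unit of `O` iff its
reduced norm is (the image of) a unit of `R` (`⇐`: `x⁻¹ = n(x)⁻¹ x̄ ∈ O` as `x̄ ∈ O`; `⇒`:
`n(x) n(y) = 1` in `R`, using `R → K` injective). [cite: VignerasLNM800, Ch. I §4 Lemme 4.12] -/
theorem exists_inv_mem_coordOrder_iff {x : ℍ⟮K; R; a, b⟯}
    (hx : x ∈ coordOrder K a b) :
    (∃ y ∈ coordOrder K a b, x * y = 1 ∧ y * x = 1) ↔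
      ∃ r : Rˣ, algebraMap R K r = reducedNorm K _ x := by
  constructor
  · rintro ⟨y, hy, hxy, -⟩
    obtain ⟨r, hr⟩ := reducedNorm_mem_range_of_mem_coordOrder K a b hx
    obtain ⟨s, hs⟩ := reducedNorm_mem_range_of_mem_coordOrder K a b hy
    have h1 : r * s = 1 := by
      apply FaithfulSMul.algebraMap_injective R K
      rw [map_mul, hr, hs, ← reducedNorm_quaternionAlgebra_mul, hxy, map_one,
        ← mul_star_self_eq_one_iff]
      simp
    exact ⟨Units.mkOfMulEqOne r s h1, hr⟩
  · rintro ⟨r, hr⟩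
    refine ⟨((r⁻¹ : Rˣ) : R) • star x, Subalgebra.smul_mem _ (star_mem_coordOrder hx) _, ?_, ?_⟩
    · rw [mul_smul_comm, mul_star_self_eq_algebraMap_reducedNorm, ← hr, Algebra.smul_def,
        ← IsScalarTower.algebraMap_apply, ← map_mul, Units.inv_mul, map_one]
    · rw [smul_mul_assoc, star_comm_self',
        mul_star_self_eq_algebraMap_reducedNorm, ← hr, Algebra.smul_def,
        ← IsScalarTower.algebraMap_apply, ← map_mul, Units.inv_mul, map_one]

variable {K a b} in
/-- `u ∈ O^× ↔ u ∈ O ∧ n(u) ∈ R^×` for a unit `u` of `ℍ[K,a,b]` (Vignéras I Lemme 4.12).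
[cite: VignerasLNM800, Ch. I §4 Lemme 4.12] -/
theorem mem_unitGroup_iff_exists_reducedNorm_eq {u : (ℍ⟮K; R; a, b⟯)ˣ} :
    u ∈ unitGroup K a b ↔ (u : ℍ⟮K; R; a, b⟯) ∈ coordOrder K a b ∧
      ∃ r : Rˣ, algebraMap R K r =
        reducedNorm K _ (u : ℍ⟮K; R; a, b⟯) := by
  rw [mem_unitGroup_iff]
  refine ⟨fun h => ⟨h.1, (exists_inv_mem_coordOrder_iff h.1).mp
    ⟨_, h.2, by simp, by simp⟩⟩, fun h => ⟨h.1, ?_⟩⟩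
  obtain ⟨y, hy, hxy, -⟩ := (exists_inv_mem_coordOrder_iff h.1).mpr h.2
  rwa [Units.inv_eq_of_mul_eq_one_right hxy]

/-- An element of `O` whose reduced norm is a unit of `R` is a unit of `ℍ[K,a,b]` lying in `O^×`
(Vignéras I Lemme 4.12, packaged with Mathlib `Units`). [cite: VignerasLNM800, Ch. I §4 Lemme 4.12] -/
theorem exists_unitGroup_val_eq {x : ℍ⟮K; R; a, b⟯}
    (hx : x ∈ coordOrder K a b) (r : Rˣ) (hr : algebraMap R K r = reducedNorm K _ x) :
    ∃ u ∈ unitGroup K a b, (u : ℍ⟮K; R; a, b⟯) = x := by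
  obtain ⟨y, hy, hxy, hyx⟩ := (exists_inv_mem_coordOrder_iff hx).mpr ⟨r, hr⟩
  exact ⟨⟨x, y, hxy, hyx⟩, ⟨hx, hy⟩, rfl⟩

end UnitsNorm

/-! ### Hecke double cosets of prime level (named fact) -/

section Hecke

open NumberField IsDedekindDomain

/-- **Hecke double cosets of prime level for `Γ = O^×`** (NAMED FACT, D-0014; users take
`(h : coordOrder_heckeDoubleCoset)`). Let `K` be a number field, `a, b ∈ 𝓞 K` non-zero with
`ℍ[K,a,b]` not totally definite (split at some infinite place — Eichler's condition C.E. for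
`S = ∞`, automatic when `K` has a complex place), `O = 𝓞_K⟨1,i,j,k⟩` the coordinate order and
`Γ = O^×` (`unitGroup`). Let `v` be a finite place with `v ∤ 2ab`, principal: `v = (ϖ)`, and let
`g ∈ O` with `g ḡ = ϖ`. Then
(i) `Γ g Γ = {x ∈ O : x x̄ ∈ (𝓞 K)^× ϖ}` (so `Γ g Γ` depends only on `v`), and
(ii) `[Γ : Γ ∩ g⁻¹ Γ g] = q_v + 1` (`q_v = #(𝓞 K / v)`, `residueCard`), i.e. `Γ g Γ` is the disjoint
union of `q_v + 1` right cosets `Γ g γᵢ` (Shimura 1971 Prop. 3.1: `Γ α Γ = ⊔_{i ≤ d} Γ αᵢ`,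
`d = [Γ : Γ ∩ α⁻¹ Γ α]`).
Source and derivation. This is the global form of Vignéras II Thm. 2.3 (3)–(4) (`M(2,R_v)` has
exactly `q_v + 1` integral left ideals of reduced norm `v`; here `O_v = R_v⟨1,i,j,k⟩ ≅ M(2,R_v)` is
maximal because its reduced discriminant `4ab` is a `v`-unit, III Cor. 5.3 and
`det_reducedTrace_basisOneIJK`), globalised by strong approximation for `H¹` (III Thm. 4.3, Kneser;
IV Thm. 1.1 (2): `O¹` is dense in `O_v¹ = SL₂(R_v)`) and the local–global dictionary for lattices
(III Prop. 5.1; IV Thm. 1.7 for indices of unit groups of orders): `Γ \ {x ∈ O : (x x̄) = v} →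
O_v^× \ O_v^× g O_v^×` is injective by Prop. 5.1 and `Γ g Γ` meets each of the `q_v + 1` local
cosets by density. It is printed verbatim for Eichler orders (e.g. over `ℚ`: Shimura, Miyake); for
the present order (not Eichler at `2ab` in general) it is the stated consequence of the cited
theorems. NOT claimed: `v ∣ 2ab`, non-principal `v`, totally definite `ℍ[K,a,b]` (where (i) fails
in general — class numbers).
[cite: VignerasLNM800, Ch. II §2 Thm. 2.3; Ch. III §4 Thm. 4.3, §5 Prop. 5.1 and Cor. 5.3; Ch. IV §1 Thm. 1.1 (2) and Thm. 1.7]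
[cite: Shimura1971, Prop. 3.1] -/
def coordOrder_heckeDoubleCoset : Prop :=
  ∀ (K : Type) [Field K] [NumberField K] (a b : 𝓞 K), a ≠ 0 → b ≠ 0 →
    ¬ IsTotallyDefinite K ℍ⟮K; 𝓞 K; a, b⟯ →
    ∀ (v : HeightOneSpectrum (𝓞 K)) (ϖ : 𝓞 K)
      (g : (ℍ⟮K; 𝓞 K; a, b⟯)ˣ),
      v.asIdeal = Ideal.span {ϖ} → (2 * a * b : 𝓞 K) ∉ v.asIdeal →
      (g : ℍ⟮K; 𝓞 K; a, b⟯) ∈ coordOrder K a b →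
      (g : ℍ⟮K; 𝓞 K; a, b⟯) * star (g : ℍ⟮K; 𝓞 K; a, b⟯) =
        algebraMap K ℍ⟮K; 𝓞 K; a, b⟯ (ϖ : K) →
      DoubleCoset.doubleCoset g
          (unitGroup K a b : Set (ℍ⟮K; 𝓞 K; a, b⟯)ˣ)
          (unitGroup K a b : Set (ℍ⟮K; 𝓞 K; a, b⟯)ˣ) =
          {x : (ℍ⟮K; 𝓞 K; a, b⟯)ˣ |
            (x : ℍ⟮K; 𝓞 K; a, b⟯) ∈ coordOrder K a b ∧
            ∃ ε : (𝓞 K)ˣ, (x : ℍ⟮K; 𝓞 K; a, b⟯) *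
              star (x : ℍ⟮K; 𝓞 K; a, b⟯) =
              algebraMap K ℍ⟮K; 𝓞 K; a, b⟯ (((ε : 𝓞 K) * ϖ : 𝓞 K) : K)} ∧
        (MulAut.conj g⁻¹ • unitGroup K a b).relIndex (unitGroup K a b) = v.residueCard + 1

end Hecke

end QuaternionAlgebra

end Literature.NumberTheory.Automorphic
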